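import Literature.NumberTheory.EllipticCurves.MultiplicativeRamifiedTorsionPowProofs
import Literature.NumberTheory.EllipticCurves.BSDSelmerPConverseRamifiedProofs
import HarnessLib

/-!
# Inertia at a multiplicative prime `ℓ` on `E[p^k]`: over `ℚ`, `p^k ∤ v_ℓ(Δ_min)` gives a GLOBAL
# unipotent element moving a point of `E[p^k]` and fixing `μ_{p^k}` (cell `b2b-bsdres`, team
# n1011, seat p14 gen 2 — row T-b10 'wild tower at 3', ARM B; steps (A′)/(D-input) of
# `cells/n1011/skel/T-b9x-nine.md`; part 1 of 2, sequel `GaloisImage/NineTowerOfTatePrime.lean`)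

HONEST FRAMING (cell `b2b-bsdres`, run/shared/lean/b2b/bsd-rank1-residual/, verbatim in every
file): the goal of the cell is to DELETE the COMBINATION-SHAPED residual classes of the
Birch–Swinnerton-Dyer formula for ALL analytic-rank `≤ 1` elliptic curves over `ℚ` — "full BSD
formula for every rank `≤ 1` curve in class `C`" assembled STRICTLY from published theorems — so
that the rank-`≤ 1` remainder becomes exactly the CONSTRUCTION-SHAPED classes, which are TYPED
(missing-input `Prop`s), NOT attempted. This is not "finishing BSD". Team n1011 (N10 / N11):
research route; no claim beyond the stated classes; labels UNCHANGED; nothing is booked. Theorems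
only (no definition, no named fact).

## What this file proves

* §1 `smul_eq_self_of_pow_eq_one_of_mem_inertia` — at a finite place `v` of a number field with
  `v ∤ N`, the inertia group `I_𝔐 ≤ Γ_{K_v}` fixes every `N`-th root of unity of `K̄_v` (a simple
  root of `X^N − 1`; tree `mem_maxUnramified_of_isRoot_map`, `mem_maxUnramified_iff_forall_inertia`).
* §2 `exists_inertia_smul_ne_pow_of_hasMultiplicativeReductionAtPrime` — over `ℚ`: multiplicative
  reduction at `ℓ` with `p^k ∤ v_ℓ(Δ_min)` ⟹ some `σ ∈ I_𝔐` moves a point `Q ∈ E(\bar ℚ_ℓ)` with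
  `p^k Q = O` (the `ℚ`-form of `exists_inertia_map_ne_pow_of_multiplicative`, written exactly as the
  tree's level-`p` wrapper `exists_inertia_smul_ne_of_hasMultiplicativeReductionAtPrime`).
* §3 `exists_unipotent_pow_of_mult_of_not_pow_dvd` — hence a GLOBAL `σ ∈ Γ_ℚ` acting on `E[p^k]`
  with `(σ − 1)² = 0` (`smul_smul_sub_eq_of_mem_inertia_of_hasMultiplicativeReductionAt`), moving a
  point of `E[p^k]` (`pointsMap_smul`, `exists_pointsMapOfEmb_eq_of_nsmul_eq_zero`), and fixing the
  `p^k`-th roots of unity of `ℚ̄` (§1 through `closureEmb_comp_resGalAux`).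

References: [SilvermanATAEC1994] V.4–V.5, Ex. 5.13(b); [SerreAbelianLadic1968] Ch. IV A.1.2;
[NeukirchANT1999] Ch. II (7.12)–(7.13), (9.11).
-/

noncomputable section

open scoped Classical NNReal

open NumberField IsDedekindDomain Field Polynomial

universe u

namespace Summit.BirchSwinnertonDyer.Rank1Residual.GaloisImage

open WeierstrassCurve Literature.NumberTheory.EllipticCurves Literature.NumberTheory.GaloisRepresentations
  Literature.NumberTheory.GaloisRepresentations.IsNonarchimedeanLocalField
  IsDedekindDomain.HeightOneSpectrum

/-! ### §1 Inertia at `v ∤ N` fixes the `N`-th roots of unity -/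

section RootsOfUnity

variable {K : Type u} [Field K] [NumberField K] {v : HeightOneSpectrum (𝓞 K)}
  {w : Valuation (AlgebraicClosure (v.adicCompletion K)) ℝ≥0}
  (hw : ∀ x, (w x : ℝ) = spectralNorm (v.adicCompletion K) (AlgebraicClosure (v.adicCompletion K)) x)

include hw in
/-- **Roots of unity of order prime to `v` are unramified**: for `ξ ∈ K̄_v` with `ξ^N = 1` and
`v ∤ N`, every element of the inertia group `I_𝔐 ≤ Γ_{K_v}` fixes `ξ` — `ξ` is a root of
`X^N − 1` which is simple modulo `𝔐` (`N ξ^{N-1}` is a unit), so `ξ ∈ K_v^nr`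
(`mem_maxUnramified_of_isRoot_map`, `mem_maxUnramified_iff_forall_inertia`).
[cite: NeukirchANT1999, Ch. II (7.12)–(7.13) (roots of unity of order prime to p are unramified)] -/
theorem smul_eq_self_of_pow_eq_one_of_mem_inertia {N : ℕ} (hN : ((N : ℤ) : 𝓞 K) ∉ v.asIdeal)
    {𝔐 : Ideal v.localAbsIntegers} (h𝔐 : 𝔐 ∈ v.localPrimesAbove)
    {σ : absoluteGaloisGroup (v.adicCompletion K)}
    (hσ : σ ∈ 𝔐.inertia (absoluteGaloisGroup (v.adicCompletion K)))
    {ξ : AlgebraicClosure (v.adicCompletion K)} (hξ : ξ ^ N = 1) :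
    absoluteGaloisGroup.toAlgEquiv (v.adicCompletion K) σ ξ = ξ := by
  have hv0 : w.Integers w.integer := Valuation.integer.integers w
  have hN0 : N ≠ 0 := by
    rintro rfl
    exact hN (by simp)
  -- `w N = 1` and `w ξ = 1`
  have hwN : w ((N : ℤ) : AlgebraicClosure (v.adicCompletion K)) = 1 :=
    spectralValuation_intCast_eq_one hw hN
  have hwξ : w ξ = 1 := by
    have h : w ξ ^ N = 1 := by rw [← map_pow, hξ, map_one]
    exact (pow_eq_one_iff.mp h).resolve_right hN0
  -- `ξ` as an element `b` of `𝒪_w`, a unit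
  set b : w.integer := ⟨ξ, (Valuation.mem_integer_iff w ξ).mpr hwξ.le⟩ with hb
  have hbu : IsUnit b := (Valuation.Integers.isUnit_iff_valuation_eq_one hv0).mpr hwξ
  have hNu : IsUnit ((N : ℤ) : w.integer) := by
    refine (Valuation.Integers.isUnit_iff_valuation_eq_one hv0).mpr ?_
    change w (((N : ℤ) : w.integer) : AlgebraicClosure (v.adicCompletion K)) = 1
    rw [show (((N : ℤ) : w.integer) : AlgebraicClosure (v.adicCompletion K)) =
      ((N : ℤ) : AlgebraicClosure (v.adicCompletion K)) from SubringClass.coe_intCast _ _]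
    exact hwN
  -- `ψ : ℤ → 𝒪_w` has image in `K_v ⊆ K_v^nr`
  set ψ : ℤ →+* w.integer := Int.castRingHom w.integer with hψ
  have hψmem : ∀ x : ℤ, ((ψ x : w.integer) : AlgebraicClosure (v.adicCompletion K)) ∈
      maxUnramified (v.adicCompletion K) := by
    intro x
    rw [hψ, eq_intCast, SubringClass.coe_intCast, ← map_intCast (algebraMap (v.adicCompletion K)
      (AlgebraicClosure (v.adicCompletion K))) x]
    exact IntermediateField.algebraMap_mem _ _
  -- `b` is a simple root of `X^N - 1`
  set f : ℤ[X] := X ^ N - 1 with hf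
  have hroot : (f.map ψ).IsRoot b := by
    rw [IsRoot, hf, Polynomial.map_sub, Polynomial.map_pow, map_X, Polynomial.map_one, eval_sub,
      eval_pow, eval_X, eval_one, sub_eq_zero]
    exact Subtype.ext (by rw [hb]; simpa using hξ)
  have hder : IsUnit ((f.map ψ).derivative.eval b) := by
    rw [hf, Polynomial.map_sub, Polynomial.map_pow, map_X, Polynomial.map_one, derivative_sub,
      derivative_X_pow, derivative_one, sub_zero, eval_mul, eval_pow, eval_X, map_natCast,
      eval_natCast]
    rw [show ((N : ℕ) : w.integer) = ((N : ℤ) : w.integer) by norm_cast]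
    exact hNu.mul (hbu.pow _)
  have hmem : (b : AlgebraicClosure (v.adicCompletion K)) ∈ maxUnramified (v.adicCompletion K) :=
    mem_maxUnramified_of_isRoot_map hw hψmem f hroot hder
  exact (mem_maxUnramified_iff_forall_inertia hw h𝔐).mp hmem σ hσ

end RootsOfUnity


/-! ### §2 Over `ℚ`: inertia at a multiplicative `ℓ` with `p^k ∤ v_ℓ(Δ_min)` moves a `p^k`-torsion point -/

section Local

set_option maxHeartbeats 1600000 in
/-- **Over `ℚ`: multiplicative reduction at `ℓ` with `p^k ∤ v_ℓ(Δ_min)` ⟹ the inertia group at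
`ℓ` moves a `p^k`-torsion point** — the `ℚ`-form of
`exists_inertia_map_ne_pow_of_multiplicative`, copied from the tree's level-`p` wrapper
`exists_inertia_smul_ne_of_hasMultiplicativeReductionAtPrime` (`W` globally minimal is minimal at
`v`; `integralModelInt W` pushed to `𝓞_v` has `c₄ ∈ 𝓞_v^×`, `Δ = d' ℓ^n` with `ℓ ∤ d'`,
`n = v_ℓ(Δ_min) ≥ 1`; transport to `E(\bar ℚ_v)` by `exists_addEquiv_localPoints_of_smul_eq`).
[cite: SilvermanATAEC1994, V.4–V.5 and Exercise 5.13(b) (PDF p. 416)] [cite: SerreAbelianLadic1968, Ch. IV, A.1.2] -/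
theorem exists_inertia_smul_ne_pow_of_hasMultiplicativeReductionAtPrime
    (W : WeierstrassCurve ℚ) [W.IsElliptic] [W.IsGloballyMinimal] (v : HeightOneSpectrum (𝓞 ℚ))
    {p : ℕ} (hp : p.Prime) (hℓp : (Rat.HeightOneSpectrum.primesEquiv v : ℕ) ≠ p)
    (hmult : haveI := Fact.mk (Rat.HeightOneSpectrum.primesEquiv v).2;
      W.HasMultiplicativeReductionAtPrime (Rat.HeightOneSpectrum.primesEquiv v))
    {k : ℕ} (hk : 1 ≤ k)
    (hram : ¬ p ^ k ∣ padicValNat (Rat.HeightOneSpectrum.primesEquiv v) W.minimalDiscriminantInt.natAbs)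
    {w : Valuation (AlgebraicClosure (v.adicCompletion ℚ)) ℝ≥0}
    (hw : ∀ x, (w x : ℝ) =
      spectralNorm (v.adicCompletion ℚ) (AlgebraicClosure (v.adicCompletion ℚ)) x)
    {𝔐 : Ideal v.localAbsIntegers} (h𝔐 : 𝔐 ∈ v.localPrimesAbove) :
    ∃ σ ∈ 𝔐.inertia (absoluteGaloisGroup (v.adicCompletion ℚ)),
      ∃ Q : localPoints W (v.adicCompletion ℚ), p ^ k • Q = 0 ∧ σ • Q ≠ Q := by
  set ℓ : ℕ := (Rat.HeightOneSpectrum.primesEquiv v : ℕ) with hℓdef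
  have hℓ : ℓ.Prime := (Rat.HeightOneSpectrum.primesEquiv v).2
  haveI hℓfact : Fact ℓ.Prime := ⟨hℓ⟩
  have hmin : W.IsMinimalAt v := IsGloballyMinimal.isMinimalAt W v
  have hmult' : W.HasMultiplicativeReductionAt v :=
    (hasMultiplicativeReductionAtPrime_iff_hasMultiplicativeReductionAt_ringOfIntegers W v).mp hmult
  obtain ⟨hΔv, hc₄v⟩ := (hasMultiplicativeReductionAt_iff_of_isMinimalAt hmin).mp hmult'
  set d : ℤ := W.minimalDiscriminantInt with hd
  have hd0 : d ≠ 0 := minimalDiscriminantInt_ne_zero W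
  set n : ℕ := padicValNat ℓ d.natAbs with hndef
  have hdvd : ((ℓ : ℤ) ^ n) ∣ d := by
    rw [← Int.natCast_pow, Int.natCast_dvd]
    exact pow_padicValNat_dvd
  obtain ⟨d', hd'⟩ := hdvd
  have hℓd' : ¬ (ℓ : ℤ) ∣ d' := by
    rintro ⟨e, rfl⟩
    have h1 : ((ℓ : ℤ) ^ (n + 1)) ∣ d := ⟨e, by rw [hd', pow_succ]; ring⟩
    rw [← Int.natCast_pow, Int.natCast_dvd] at h1
    exact pow_succ_padicValNat_not_dvd (Int.natAbs_ne_zero.mpr hd0) h1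
  set X₀ : WeierstrassCurve (v.adicCompletionIntegers ℚ) :=
    (integralModelInt W).map (Int.castRingHom (v.adicCompletionIntegers ℚ)) with hX₀
  have hX₀Δ : X₀.Δ = (d' : v.adicCompletionIntegers ℚ) * ((ℓ : ℕ) : v.adicCompletionIntegers ℚ) ^ n := by
    rw [hX₀, map_Δ, eq_intCast]
    change ((minimalDiscriminantInt W : ℤ) : v.adicCompletionIntegers ℚ) = _
    rw [← hd, hd']
    push_cast
    ring
  have hval : ∀ z : ℤ, Valued.v ((z : v.adicCompletionIntegers ℚ) : v.adicCompletion ℚ) =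
      v.valuation ℚ (z : ℚ) := by
    intro z
    have hcoe : ((z : v.adicCompletionIntegers ℚ) : v.adicCompletion ℚ) =
        algebraMap ℚ (v.adicCompletion ℚ) (z : ℚ) := by
      rw [map_intCast]; exact SubringClass.coe_intCast _ z
    rw [hcoe, IsDedekindDomain.HeightOneSpectrum.algebraMap_adicCompletion]
    exact IsDedekindDomain.HeightOneSpectrum.valuedAdicCompletion_eq_valuation' v (z : ℚ)
  have hu : IsUnit (d' : v.adicCompletionIntegers ℚ) := by
    rw [IsDedekindDomain.HeightOneSpectrum.adicCompletionIntegers.isUnit_iff_valued_eq_one, hval]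
    exact valuation_ringOfIntegers_intCast_eq_one v hℓd'
  have hπ : Irreducible ((ℓ : ℕ) : v.adicCompletionIntegers ℚ) :=
    Literature.NumberTheory.DiophantineGeometry.Rat.irreducible_natCast_natGenerator v
  have hWΔ : W.Δ = (d : ℚ) := by rw [hd, cast_minimalDiscriminantInt]
  have hn1 : 1 ≤ n := by
    by_contra h0
    have hn0 : n = 0 := by omega
    have hdd' : d = d' := by rw [hd', hn0, pow_zero, one_mul]
    have h1 : v.valuation ℚ (d : ℚ) = 1 := by
      rw [hdd']; exact valuation_ringOfIntegers_intCast_eq_one v hℓd'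
    rw [hWΔ, h1] at hΔv
    exact lt_irrefl _ hΔv
  have hc₄ : X₀.c₄ ∉ IsLocalRing.maximalIdeal (v.adicCompletionIntegers ℚ) := by
    intro hmem
    have hWc₄ : W.c₄ = ((integralModelInt W).c₄ : ℚ) := by
      conv_lhs => rw [← map_integralModelInt W]
      rw [map_c₄, eq_intCast]
    have hunit : IsUnit X₀.c₄ := by
      rw [IsDedekindDomain.HeightOneSpectrum.adicCompletionIntegers.isUnit_iff_valued_eq_one, hX₀,
        map_c₄, eq_intCast, hval, ← hWc₄]
      exact hc₄v
    exact (IsLocalRing.mem_maximalIdeal _).mp hmem hunit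
  have hpv : (p : 𝓞 ℚ) ∉ v.asIdeal := by
    intro hmem
    have hv := (natCast_mem_asIdeal_iff_eq_primesEquiv_symm v hp).mp hmem
    apply hℓp
    rw [hℓdef, hv, Equiv.apply_symm_apply]
  have hpn : ¬ p ^ k ∣ n := hram
  obtain ⟨σ, hσ, P, hpP, hσP⟩ :=
    exists_inertia_map_ne_pow_of_multiplicative hw X₀ hu hπ hn1 hX₀Δ hc₄ hp hpv hk hpn h𝔐
  have hXW : (1 : VariableChange (v.adicCompletion ℚ)) • W.baseChange (v.adicCompletion ℚ) =
      X₀.baseChange (v.adicCompletion ℚ) := by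
    rw [one_smul, hX₀]
    conv_lhs => rw [← map_integralModelInt W]
    simp only [baseChange, WeierstrassCurve.map_map]
    congr 1
    exact RingHom.ext_int _ _
  obtain ⟨Φ, hΦ⟩ := W.exists_addEquiv_localPoints_of_smul_eq v hXW
  refine ⟨σ, hσ, Φ.symm P, ?_, fun h ↦ hσP ?_⟩
  · apply Φ.injective
    rw [map_nsmul, AddEquiv.apply_symm_apply, hpP, map_zero]
  · have := hΦ σ (Φ.symm P)
    rw [h, AddEquiv.apply_symm_apply] at this
    exact this.symm

end Local

/-! ### §3 The global unipotent element for `E/ℚ` -/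

section Global

variable (W : WeierstrassCurve ℚ) [W.IsElliptic] [W.IsGloballyMinimal]

/-- **A multiplicative prime `ℓ ≠ p` with `p^k ∤ v_ℓ(Δ_min)` yields `σ ∈ Γ_ℚ` unipotent of order
two on `E[p^k]`, moving a point of `E[p^k]`, and fixing the `p^k`-th roots of unity** (restriction
to `ℚ̄` of an inertia element at `ℓ`: `smul_smul_sub_eq_of_mem_inertia_of_hasMultiplicativeReductionAt`,
§2, §1, `pointsMap_smul`, `closureEmb`).
[cite: SilvermanATAEC1994, V.4–V.5 and Exercise 5.13(b) (PDF p. 416)] [cite: SerreAbelianLadic1968, Ch. IV, A.1.2] -/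
theorem exists_unipotent_pow_of_mult_of_not_pow_dvd {p : ℕ} (hp : p.Prime) {ℓ : ℕ} [Fact ℓ.Prime]
    (hℓp : ℓ ≠ p) (hmult : W.HasMultiplicativeReductionAtPrime ℓ) {k : ℕ} (hk : 1 ≤ k)
    (hram : ¬ p ^ k ∣ padicValNat ℓ W.minimalDiscriminantInt.natAbs) :
    ∃ σ : absoluteGaloisGroup ℚ,
      (∀ P ∈ geomTorsion W ((p ^ k : ℕ) : ℤ), σ • (σ • P - P) = σ • P - P) ∧
      (∃ Q ∈ geomTorsion W ((p ^ k : ℕ) : ℤ), σ • Q ≠ Q) ∧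
      ∀ ζ : AlgebraicClosure ℚ, ζ ^ p ^ k = 1 → σ • ζ = ζ := by
  -- the place `v` of `𝓞 ℚ` over `ℓ`
  set v : HeightOneSpectrum (𝓞 ℚ) := (Rat.HeightOneSpectrum.primesEquiv (R := 𝓞 ℚ)).symm
    ⟨ℓ, Fact.out⟩ with hvdef
  have hvℓ : (Rat.HeightOneSpectrum.primesEquiv v : ℕ) = ℓ := by
    rw [hvdef, Equiv.apply_symm_apply]
  have hmult' : haveI := Fact.mk (Rat.HeightOneSpectrum.primesEquiv v).2;
      W.HasMultiplicativeReductionAtPrime (Rat.HeightOneSpectrum.primesEquiv v) := by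
    generalize hq : Rat.HeightOneSpectrum.primesEquiv v = q
    obtain ⟨q, hq'⟩ := q
    have : q = ℓ := by rw [← hvℓ, hq]
    subst this
    exact hmult
  have hmultv : W.HasMultiplicativeReductionAt v :=
    (hasMultiplicativeReductionAtPrime_iff_hasMultiplicativeReductionAt_ringOfIntegers W v).mp hmult'
  have hpv : (p : 𝓞 ℚ) ∉ v.asIdeal := by
    intro hmem
    have h := (natCast_mem_asIdeal_iff_eq_primesEquiv_symm v hp).mp hmem
    apply hℓp
    have := congrArg (fun q : Nat.Primes ↦ (q : ℕ)) (congrArg Rat.HeightOneSpectrum.primesEquiv h)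
    simp only [Equiv.apply_symm_apply] at this
    rw [hvℓ] at this
    exact this
  have hpkv : (((p ^ k : ℕ) : ℤ) : 𝓞 ℚ) ∉ v.asIdeal := by
    intro hmem
    apply hpv
    have h' : ((p : 𝓞 ℚ)) ^ k ∈ v.asIdeal := by
      have : (((p ^ k : ℕ) : ℤ) : 𝓞 ℚ) = (p : 𝓞 ℚ) ^ k := by push_cast; ring
      rwa [this] at hmem
    exact v.isPrime.mem_of_pow_mem _ h'
  -- the spectral valuation and the prime of `\bar 𝓞_v`
  obtain ⟨w, hw⟩ := exists_spectralValuation (v := v) (K := ℚ)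
  obtain ⟨𝔐, h𝔐⟩ := v.localPrimesAbove_nonempty
  obtain ⟨τ, hτ, Q, hQ, hτQ⟩ := exists_inertia_smul_ne_pow_of_hasMultiplicativeReductionAtPrime W v hp
    (by rw [hvℓ]; exact hℓp) hmult' hk (by rw [hvℓ]; exact hram) hw h𝔐
  have hinj : Function.Injective (pointsMap W (v.adicCompletion ℚ)) := pointsMapOfEmb_injective W _
  refine ⟨resGal (K := ℚ) (v.adicCompletion ℚ) τ, fun P hP ↦ ?_, ?_, fun ζ hζ ↦ ?_⟩
  · -- `(σ - 1)² = 0` on `E[p^k]`, read in `E(\bar ℚ_v)`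
    have hP' : p ^ k • pointsMap W (v.adicCompletion ℚ) P = 0 := by
      rw [← map_nsmul, ← natCast_zsmul, (Submodule.mem_torsionBy_iff _ _).mp hP, map_zero]
    have key := W.smul_smul_sub_eq_of_mem_inertia_of_hasMultiplicativeReductionAt hmultv hp hpv hk
      hw h𝔐 hτ (pointsMap W (v.adicCompletion ℚ) P) hP'
    apply hinj
    simp only [map_sub, pointsMap_smul]
    exact key
  · -- the moved point comes from `E(ℚ̄)`
    obtain ⟨P₀, hpP₀, hP₀Q⟩ := exists_pointsMapOfEmb_eq_of_nsmul_eq_zero W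
      (closureEmb (K := ℚ) (v.adicCompletion ℚ)) (pow_ne_zero k hp.ne_zero) hQ
    refine ⟨P₀, (Submodule.mem_torsionBy_iff _ _).mpr (by rw [natCast_zsmul]; exact hpP₀),
      fun h ↦ hτQ ?_⟩
    have h' := congrArg (pointsMap W (v.adicCompletion ℚ)) h
    rw [pointsMap_smul] at h'
    change pointsMap W (v.adicCompletion ℚ) P₀ = Q at hP₀Q
    rw [← hP₀Q]
    exact h'
  · -- `σ` fixes the `p^k`-th roots of unity: `τ` fixes their images in `\bar ℚ_v` (§1)
    apply (closureEmb (K := ℚ) (v.adicCompletion ℚ)).toRingHom.injective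
    have h1 : closureEmb (K := ℚ) (v.adicCompletion ℚ) (resGal (K := ℚ) (v.adicCompletion ℚ) τ • ζ) =
        τ • closureEmb (K := ℚ) (v.adicCompletion ℚ) ζ :=
      AlgHom.congr_fun (closureEmb_comp_resGalAux (K := ℚ) (v.adicCompletion ℚ) τ) ζ
    change closureEmb (K := ℚ) (v.adicCompletion ℚ) (resGal (K := ℚ) (v.adicCompletion ℚ) τ • ζ) =
      closureEmb (K := ℚ) (v.adicCompletion ℚ) ζ
    rw [h1]
    exact smul_eq_self_of_pow_eq_one_of_mem_inertia hw hpkv h𝔐 hτ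
      (by rw [← map_pow, hζ, map_one])

end Global

end Summit.BirchSwinnertonDyer.Rank1Residual.GaloisImage

end
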